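/-
Copyright (c) 2026 the pub-hodgecm-mathlib formalisation cell (harness21).  Prover seat hodgecm-mathlib-K2E3-p27 (g4), Track B «K2-LIT», h413 = `stmt-HodgeConjecture-24833`,
route `HCCMUnconditional`, R90-TF S8; deal S8-R251 (S8 dealer R90-CS-plan (g3), «:40 REPORT #4» 2026-09-05T03:24:42Z): STR — the RUNG-1 STRUCTURAL BINDERS of ★ p863444
`exists_blockModelFamily_top` at the top row `(K_max, 1)` DISCHARGED (measures `νG μK νI 𝓕I ν 𝓕`, `β μZ`, `c² = 1`, `σ₀`, and per self-dual block the normalised section `φ₀_b`).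
-/
import Summits.HodgeConjecture.HodgeConjecture.Theorems.R90S8ResHBlockModelFamilyTopU2               -- ★ p863444 (K2E1-p15): `exists_blockModelFamily_top`; brings ★ `resHBlock ∕ resHAtom ∕ resHLine`, ★ M1' p863337, ★ D4′ p862711, ★ `isUnitary_coe_index`
import Summits.HodgeConjecture.HodgeConjecture.Theorems.K2E1ResidualBlockPackageSelfDualM1CMTwo      -- ★ (K2E4-p23): `eq_zero_of_apply_one_eq_zero`; brings ★ `exists_unipotent_binders_cm_two`, ★ `hVinf_maximalLevel_of_selfDual_cm`, ★ `exists_bound_of_isChiSection_of_isUnitary`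
import Summits.HodgeConjecture.HodgeConjecture.Theorems.K2E1SphericalEisensteinStructuralDataCMTwo    -- ★ (K2E1-p10): `exists_haar_coveringWeight_unfoldedMeasure_cm_two` (`νG`, `β`, `μZ`)
import Summits.HodgeConjecture.HodgeConjecture.Theorems.K2E1ChiSectionContinuousMaximalLevelCMTwo    -- ★ (K2E2-p12): `hVc_maximalLevel_one` (sections of `V(χ, K_max, 1)` are continuous)
import Literature.NumberTheory.Automorphic.UnitaryGroupTorusIdeleUnfolding                          -- ★ `locallyCompactSpace_secondCountable_t2_idele`
import Literature.NumberTheory.Automorphic.UnitaryGroupIwasawaIntegration                           -- ★ `isCompact_comap_adelicVal_standardMaximalCompactGL`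
import HarnessLib

/-!
# S8 #4′ road — `R90S8ResHTopStructuralBindersU2`: THE TOP ROW'S STRUCTURAL BINDERS ARE INHABITED, and ★ p863444 `exists_blockModelFamily_top` BINDER-FREE

Track B ∕ K2-LIT, crux h413 = `stmt-HodgeConjecture-24833`, route of record `HCCMUnconditional`; cell `hodgecm-mathlib`, R90-TF S8 «ContSpec-n½», socket #4′
`sock_S8_resH_spannedByCharLines` (`Lines/R90_S8_ResidualSpectrumU3B.lean` ED. 7 :494–:503); S8 dealer R90-CS-plan (g3) deal S8-R251 «STR» (letter STR of the #4′ LETTER LEDGER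
`K2/K2E3-p27/g4/CENSUS-S8B-4prime-LetterLedger.K2E3-p27-g4.md` d671e7fbcdfe0e15).  THEOREMS ONLY (no `def`, no `instance`, no `notation`, no named-fact hypothesis, no `sorry`; default
heartbeats); lane `--supports stmt-HodgeConjecture-24833 --as helper` (count-neutral).  CLOSES NO SOCKET.

WHY ([MoeglinWaldspurger1995, I.2.1, II.1.7, II.2.4, VI.2]; [CasselsFrohlichANT1967, Ch. XV Thm. 4.1.3]; [BorelJacquet1979, §4.1]).  ★ p863444 `exists_blockModelFamily_top` — the TOP ROW
`(K_max, ω = 1)` of the #4′ row packaging (★ p865023 `resH_spannedByCharLines_of_rows_quasiSplit`) — keeps VISIBLE the RUNG-1 structural binders: a Haar measure `νG` of `U(J₂)(𝔸_{L⁺})`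
(inversion-invariant, s-finite), a Haar measure `μK` of `K_max = adelicVal⁻¹(K_∞·GL₂(𝒪̂_L))`, a Haar measure `νI` of `𝔸_Lˣ` with an idele class domain `𝓕I`, a right- and
inversion-invariant Haar measure `ν` of the radical `N(𝔸) ≅ 𝔸_L⁻` with a fundamental domain `𝓕` of `N(L⁺)` of mass `1` and compact closure, a covering weight `β` of `B(L⁺)♯` with its unfolded
s-finite measure `μZ` on `B(L⁺)∖U(J₂)(𝔸)`, `c² = 1`, `σ₀ > 1`, and FOR EVERY SELF-DUAL BLOCK `b` a normalised section `φ₀_b ∈ V(χ_b, K_max, 1)` (`hφV hφc hφM hφinf hφ1 hφ1r`) with its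
`L²(K_max)` representative `v_b`.  Every one of them is inhabited by ★ frames: `νG β μZ` ★ `exists_haar_coveringWeight_unfoldedMeasure_cm_two` (K2E1-p10); `(𝓕I) (ν 𝓕, ν 𝓕 = 1)` ★
`exists_unipotent_binders_cm_two` (Tate's transported domain, rescaled) + ★ `isMulRightInvariant_of_isMulLeftInvariant_two` (`N(𝔸)` abelian); `μK νI` = Mathlib `haar` on the compact
`K_max` (★ `isCompact_comap_adelicVal_standardMaximalCompactGL`) and on `𝔸_Lˣ` (★ `locallyCompactSpace_secondCountable_t2_idele`); `c² = 1` by `IsCMField.complexConj_apply_apply`; `σ₀ := 2`;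
and `φ₀_b := (φ 1)⁻¹ • φ` for any non-zero `φ ∈ V(χ_b, K_max, 1)` (`≠ ⊥` is the index clause) — `φ 1 ≠ 0` by ★ `eq_zero_of_apply_one_eq_zero`, continuity ★ `hVc_maximalLevel_one`, the
bound ★ `exists_bound_of_isChiSection_of_isUnitary` (`χ_b` unitary: ray-trivial, ★ `isUnitary_coe_index`), `hφinf` ★ `hVinf_maximalLevel_of_selfDual_cm` (K2E4-p14), `φ₀ 1 = 1` — the
recipe of ★ `selfDual_block_package` (K2E4-p23), here per block of the C7 index.
* §1 **`exists_structuralBinders_top`** — `∃ νG μK νI 𝓕I ν 𝓕 β μZ` with every structural clause of ★ p863444, and `c * c = 1`.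
* §2 **`exists_normalisedSection_selfDual_top`** — for every finite measure `μK` on `K_max` and every SELF-DUAL block `b` of the top C7 index: `∃ φ₀ Mφ v`, `hφV ∧ hφc ∧ hφM ∧ hφinf ∧ hφ1 ∧ hφ1r ∧ hv`.
* §3 **`exists_blockModelFamily_top_of_record`** — ★ p863444's CONCLUSION VERBATIM with NO structural binder left (`(L μ) [IsAutomorphicMeasure μ]` only; Borel σ-algebras by `borel _`):
  the top row's block-model family `U` with `hUfac ∧ hUinj ∧ hOD ∧ (O)`.
HONEST LABEL: HC_CM is proved only modulo the 7 printed citations (2 remaining named inputs: hLiu418 = `stmt-HodgeConjecture-24832`, h413 = `stmt-HodgeConjecture-24833`) until rung 0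
closes; REL ≠ ★ ≠ BUILT; this file asserts no named fact and closes no socket (#4′ stays OPEN: the top row still owes (N_blk)-SD re-pointing and (L) X1+X2, the rows below `K_max` ∕ at `ω ≠ 1`
are the G9 LEVEL package); count-neutral.

## References
* [MoeglinWaldspurger1995] C. Mœglin, J.-L. Waldspurger, *Spectral Decomposition and Eisenstein Series* (1995), I.2.1, II.1.7, II.2.4, VI.2.
* [CasselsFrohlichANT1967] J. Tate, *Fourier analysis in number fields and Hecke's zeta-functions*, in Cassels–Fröhlich (1967), Ch. XV Thm. 4.1.3.
* [BorelJacquet1979] A. Borel, H. Jacquet, *Automorphic forms and automorphic representations*, PSPM 33.1 (1979), §4.1.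
* [ReedSimonI1980] M. Reed, B. Simon, *Methods of Modern Mathematical Physics I* (1980), Thm. II.3.
-/

set_option autoImplicit false
set_option linter.dupNamespace false  -- the mandated namespace `…HodgeConjecture.HodgeConjecture.R90.S8` (LEAD #1 L1) repeats the summit's segment

noncomputable section

open MeasureTheory MeasureTheory.Measure Set NumberField IsDedekindDomain Filter Topology Complex
open scoped Real NNReal ENNReal ComplexConjugate InnerProductSpace BigOperators
open Literature.MeasureTheory.Group Literature.NumberTheory
open Literature.NumberTheory.Automorphic Literature.NumberTheory.Automorphic.UnitaryGroup AdelicGroupData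
open Literature.NumberTheory.GaloisRepresentations
open Summit.HodgeConjecture.HodgeConjecture.Cruxes.H413.K2E1BorelEisensteinU
open Summit.HodgeConjecture.HodgeConjecture.Cruxes.H413.K2E1BLBorelSpacesU2Defs
open Summit.HodgeConjecture.HodgeConjecture.Cruxes.H413.K2E1BLBorelOperatorsU2Defs
open Summit.HodgeConjecture.HodgeConjecture.Cruxes.H413.K2E1CharacterEisensteinU2Defs
open Summit.HodgeConjecture.HodgeConjecture.Cruxes.H413.K2E1ChiSectionSpaceU2Defs
open Summit.HodgeConjecture.HodgeConjecture.Cruxes.H413.K2E1ChiSectionBoundedOfUnitaryU2 (exists_bound_of_isChiSection_of_isUnitary)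
open Summit.HodgeConjecture.HodgeConjecture.Cruxes.H413.K2E1SphericalEisensteinStructuralDataCMTwo (exists_haar_coveringWeight_unfoldedMeasure_cm_two)
open Summit.HodgeConjecture.HodgeConjecture.Cruxes.H413.K2E1MaassSelbergCMTwoFinal (exists_unipotent_binders_cm_two)
open Summit.HodgeConjecture.HodgeConjecture.Cruxes.H413.K2E1ChiSectionArchConstantSelfDualCMTwo (hVinf_maximalLevel_of_selfDual_cm)
open Summit.HodgeConjecture.HodgeConjecture.Cruxes.H413.K2E1ChiSectionContinuousMaximalLevelCMTwo (hVc_maximalLevel_one)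
open Summit.HodgeConjecture.HodgeConjecture.Cruxes.H413.K2E1ResidualBlockPackageSelfDualM1CMTwo (eq_zero_of_apply_one_eq_zero)

namespace Summit.HodgeConjecture.HodgeConjecture.R90.S8

variable (L : Type) [Field L] [NumberField L] [IsCMField L]

/-! ## §1 The measure-theoretic binders of the top row are inhabited -/

/-- **THE RUNG-1 STRUCTURAL BINDERS OF ★ p863444 AT `(K_max, 1)` ARE INHABITED**: a Haar measure `νG` of `U(J₂)(𝔸_{L⁺})`, inversion-invariant and s-finite, a Haar measure `μK` of the compact
`K_max`, a Haar measure `νI` of `𝔸_Lˣ` with an idele class domain `𝓕I`, a right- and inversion-invariant Haar measure `ν` of `N(𝔸)` with a fundamental domain `𝓕` of `N(L⁺)` of `ν`-mass `1`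
and compact closure, a covering weight `β` of `B(L⁺)♯` with its s-finite unfolded measure `μZ` on `B(L⁺)∖U(J₂)(𝔸)`, and `c² = 1` (★ `exists_haar_coveringWeight_unfoldedMeasure_cm_two`, ★
`exists_unipotent_binders_cm_two`, ★ `isMulRightInvariant_of_isMulLeftInvariant_two`, Mathlib `haar` on `K_max` ∕ `𝔸_Lˣ`).
[cite: MoeglinWaldspurger1995, I.2.1, II.1.7] [cite: CasselsFrohlichANT1967, Ch. XV Thm. 4.1.3] [cite: BorelJacquet1979, §4.1] -/
theorem exists_structuralBinders_top
    [MeasurableSpace (quasiSplit (↥(maximalRealSubfield L)) L (IsCMField.complexConj L) 2).Adelic] [BorelSpace (quasiSplit (↥(maximalRealSubfield L)) L (IsCMField.complexConj L) 2).Adelic] [MeasurableSpace (AdeleRing (𝓞 L) L)ˣ] [BorelSpace (AdeleRing (𝓞 L) L)ˣ] :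
    ∃ (νG : Measure (quasiSplit (↥(maximalRealSubfield L)) L (IsCMField.complexConj L) 2).Adelic) (_ : νG.IsHaarMeasure) (_ : νG.IsInvInvariant) (_ : SFinite νG)
      (μK : Measure ↥(((standardMaximalCompactGL 2 L).comap (adelicVal (↥(maximalRealSubfield L)) L (IsCMField.complexConj L) 2 ((StdForm.antidiagonal 2).over L)) : Subgroup (quasiSplit (↥(maximalRealSubfield L)) L (IsCMField.complexConj L) 2).Adelic))) (_ : μK.IsHaarMeasure)
      (νI : Measure (AdeleRing (𝓞 L) L)ˣ) (_ : νI.IsHaarMeasure) (𝓕I : Set (AdeleRing (𝓞 L) L)ˣ) (_ : IsIdeleClassDomain L 𝓕I)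
      (ν : Measure ↥(adelicUnipotent (↥(maximalRealSubfield L)) L (IsCMField.complexConj L) 2)) (_ : ν.IsHaarMeasure) (_ : ν.IsMulRightInvariant) (_ : ν.IsInvInvariant)
      (𝓕 : Set ↥(adelicUnipotent (↥(maximalRealSubfield L)) L (IsCMField.complexConj L) 2)) (_ : IsFundamentalDomain ↥(rationalUnipotent (↥(maximalRealSubfield L)) L (IsCMField.complexConj L) 2) 𝓕 ν) (_ : ν 𝓕 = 1) (_ : IsCompact (closure 𝓕))
      (β : (quasiSplit (↥(maximalRealSubfield L)) L (IsCMField.complexConj L) 2).Adelic → ℝ≥0∞) (_ : IsCoveringWeight ↥((arithmeticBorel (↥(maximalRealSubfield L)) L (IsCMField.complexConj L) 2).map (quasiSplit (↥(maximalRealSubfield L)) L (IsCMField.complexConj L) 2).arithmeticSubgroup.subtype) β)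
      (μZ : Measure (borelQuotient (↥(maximalRealSubfield L)) L (IsCMField.complexConj L) 2)) (_ : SFinite μZ),
      (∀ f : (borelQuotient (↥(maximalRealSubfield L)) L (IsCMField.complexConj L) 2) → ℝ≥0∞, Measurable f → ∫⁻ z, f z ∂μZ = ∫⁻ g, β g * f (toBorelQuotient (↥(maximalRealSubfield L)) L (IsCMField.complexConj L) 2 g) ∂νG) ∧
      IsCMField.complexConj L * IsCMField.complexConj L = 1 := by
  -- the `G`-side ★ (K2E1-p10): `νG`, `β`, `μZ`
  have HG := exists_haar_coveringWeight_unfoldedMeasure_cm_two L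
  obtain ⟨νG, β, μZ, hνG, -, hνGinv, hνGsf, hβ, hμZsf, hμZ⟩ := HG
  -- the radical and the idele class domain ★ (`ν 𝓕 = 1` already normalised)
  have HN := exists_unipotent_binders_cm_two L
  obtain ⟨⟨𝓕I, h𝓕I⟩, ν, hν, hνinv, 𝓕, h𝓕N, h𝓕1, h𝓕c⟩ := HN
  haveI := hν
  have hνr : ν.IsMulRightInvariant := isMulRightInvariant_of_isMulLeftInvariant_two ν
  -- Haar measures on the compact `K_max` and on `𝔸_Lˣ`
  haveI : CompactSpace ↥(((standardMaximalCompactGL 2 L).comap (adelicVal (↥(maximalRealSubfield L)) L (IsCMField.complexConj L) 2 ((StdForm.antidiagonal 2).over L)) : Subgroup (quasiSplit (↥(maximalRealSubfield L)) L (IsCMField.complexConj L) 2).Adelic)) :=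
    isCompact_iff_compactSpace.1 isCompact_comap_adelicVal_standardMaximalCompactGL
  obtain ⟨hI1, hI2, hI3⟩ := locallyCompactSpace_secondCountable_t2_idele (E := L)
  exact ⟨νG, hνG, hνGinv, hνGsf, haar, inferInstance, haar, inferInstance, 𝓕I, h𝓕I, ν, hν, hνr, hνinv, 𝓕, h𝓕N, h𝓕1, h𝓕c, β, hβ, μZ, hμZsf, hμZ,
    AlgEquiv.ext fun x => IsCMField.complexConj_apply_apply L x⟩

/-! ## §2 Per self-dual block of the top C7 index: the normalised section `φ₀_b` -/

/-- **THE NORMALISED SECTION OF A SELF-DUAL BLOCK AT THE TOP LEVEL**: for a block `b` of the C7 index `S_1(K_max)` (ray-trivial `χ_b`, `V(χ_b, K_max, 1) ≠ ⊥`) with `χ_bʷ = χ_b`, and any finite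
measure `μK` on `K_max`: a section `φ₀ ∈ V(χ_b, K_max, 1)` which is continuous (★ `hVc_maximalLevel_one`), bounded (★ `exists_bound_of_isChiSection_of_isUnitary`, `χ_b` unitary ★
`isUnitary_coe_index`), archimedean-constant `φ₀(ι_∞ a) = φ₀(1)` (★ `hVinf_maximalLevel_of_selfDual_cm`), with `φ₀ 1 = 1` (so `≠ 0` and real: `φ₀ := (φ 1)⁻¹ • φ`, `φ 1 ≠ 0` by ★
`eq_zero_of_apply_one_eq_zero`), together with its `L²(K_max, μK)` class `v`. [cite: MoeglinWaldspurger1995, I.2.17, II.1.7] [cite: BorelJacquet1979, §4.1] -/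
theorem exists_normalisedSection_selfDual_top
    [MeasurableSpace (quasiSplit (↥(maximalRealSubfield L)) L (IsCMField.complexConj L) 2).Adelic] [BorelSpace (quasiSplit (↥(maximalRealSubfield L)) L (IsCMField.complexConj L) 2).Adelic]
    (μK : Measure ↥(((standardMaximalCompactGL 2 L).comap (adelicVal (↥(maximalRealSubfield L)) L (IsCMField.complexConj L) 2 ((StdForm.antidiagonal 2).over L)) : Subgroup (quasiSplit (↥(maximalRealSubfield L)) L (IsCMField.complexConj L) 2).Adelic))) [IsFiniteMeasure μK]
    (b : ↥{χ : HeckeCharacter L | (∀ r : ℝ≥0ˣ, χ (posRealIdele L r) = 1) ∧ chiSectionSpace χ (((standardMaximalCompactGL 2 L).comap (adelicVal (↥(maximalRealSubfield L)) L (IsCMField.complexConj L) 2 ((StdForm.antidiagonal 2).over L)) : Subgroup (quasiSplit (↥(maximalRealSubfield L)) L (IsCMField.complexConj L) 2).Adelic)) (((1 : ↥(((standardMaximalCompactGL 2 L).comap (adelicVal (↥(maximalRealSubfield L)) L (IsCMField.complexConj L) 2 ((StdForm.antidiagonal 2).over L)) : Subgroup (quasiSplit (↥(maximalRealSubfield L))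 L (IsCMField.complexConj L) 2).Adelic)) →* ℂ)) : ↥(((standardMaximalCompactGL 2 L).comap (adelicVal (↥(maximalRealSubfield L)) L (IsCMField.complexConj L) 2 ((StdForm.antidiagonal 2).over L)) : Subgroup (quasiSplit (↥(maximalRealSubfield L)) L (IsCMField.complexConj L) 2).Adelic)) → ℂ) ≠ ⊥}) (hsd : reflectChar (IsCMField.complexConj L) (b : HeckeCharacter L) = (b : HeckeCharacter L)) :
    ∃ (φ₀ : (quasiSplit (↥(maximalRealSubfield L)) L (IsCMField.complexConj L) 2).Adelic → ℂ) (Mφ : ℝ) (v : Lp ℂ 2 μK),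
      φ₀ ∈ chiSectionSpace (b : HeckeCharacter L) (((standardMaximalCompactGL 2 L).comap (adelicVal (↥(maximalRealSubfield L)) L (IsCMField.complexConj L) 2 ((StdForm.antidiagonal 2).over L)) : Subgroup (quasiSplit (↥(maximalRealSubfield L)) L (IsCMField.complexConj L) 2).Adelic)) (fun _ => 1) ∧ Continuous φ₀ ∧ (∀ x, ‖φ₀ x‖ ≤ Mφ) ∧
        (∀ a : arch (↥(maximalRealSubfield L)) L (IsCMField.complexConj L) 2 ((StdForm.antidiagonal 2).over L), φ₀ (archToAdelic (↥(maximalRealSubfield L)) L (IsCMField.complexConj L) 2 _ a) = φ₀ 1) ∧ φ₀ 1 ≠ 0 ∧ conj (φ₀ 1) = φ₀ 1 ∧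
        ((v : Lp ℂ 2 μK) : ↥(((standardMaximalCompactGL 2 L).comap (adelicVal (↥(maximalRealSubfield L)) L (IsCMField.complexConj L) 2 ((StdForm.antidiagonal 2).over L)) : Subgroup (quasiSplit (↥(maximalRealSubfield L)) L (IsCMField.complexConj L) 2).Adelic)) → ℂ) =ᵐ[μK] fun k => φ₀ (k : (quasiSplit (↥(maximalRealSubfield L)) L (IsCMField.complexConj L) 2).Adelic) := by
  -- a non-zero vector of the line `V(χ_b, K_max, 1)` (the index clause), normalised at `1`
  have Hne := (Submodule.ne_bot_iff _).1 b.2.2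
  obtain ⟨φ, hφV', hφne⟩ := Hne
  have hφV : φ ∈ chiSectionSpace (b : HeckeCharacter L) (((standardMaximalCompactGL 2 L).comap (adelicVal (↥(maximalRealSubfield L)) L (IsCMField.complexConj L) 2 ((StdForm.antidiagonal 2).over L)) : Subgroup (quasiSplit (↥(maximalRealSubfield L)) L (IsCMField.complexConj L) 2).Adelic)) (fun _ => 1) := hφV'
  have hφ1 : φ 1 ≠ 0 := fun h0 => hφne (eq_zero_of_apply_one_eq_zero L hφV h0)
  have hψV : ((φ 1)⁻¹ • φ) ∈ chiSectionSpace (b : HeckeCharacter L) (((standardMaximalCompactGL 2 L).comap (adelicVal (↥(maximalRealSubfield L)) L (IsCMField.complexConj L) 2 ((StdForm.antidiagonal 2).over L)) : Subgroup (quasiSplit (↥(maximalRealSubfield L)) L (IsCMField.complexConj L) 2).Adelic)) (fun _ => 1) := Submodule.smul_mem _ _ hφV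
  have hψc : Continuous ((φ 1)⁻¹ • φ) := hVc_maximalLevel_one L (b : HeckeCharacter L) _ hψV
  have hψ1 : ((φ 1)⁻¹ • φ) 1 = 1 := by rw [Pi.smul_apply, smul_eq_mul, inv_mul_cancel₀ hφ1]
  have hχu : (b : HeckeCharacter L).IsUnitary := isUnitary_coe_index L (((standardMaximalCompactGL 2 L).comap (adelicVal (↥(maximalRealSubfield L)) L (IsCMField.complexConj L) 2 ((StdForm.antidiagonal 2).over L)) : Subgroup (quasiSplit (↥(maximalRealSubfield L)) L (IsCMField.complexConj L) 2).Adelic)) (1 : ↥(((standardMaximalCompactGL 2 L).comap (adelicVal (↥(maximalRealSubfield L)) L (IsCMField.complexConj L) 2 ((StdForm.antidiagonal 2).over L)) : Subgroup (quasiSplit (↥(maximalRealSubfield L)) L (IsCMField.complexConj L) 2).Adelic)) →* ℂ) b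
  have HM := exists_bound_of_isChiSection_of_isUnitary L 2 hχu (isChiSection_of_mem hψV) hψc
  obtain ⟨Mφ, hψM⟩ := HM
  have hvm : MemLp (fun k : ↥(((standardMaximalCompactGL 2 L).comap (adelicVal (↥(maximalRealSubfield L)) L (IsCMField.complexConj L) 2 ((StdForm.antidiagonal 2).over L)) : Subgroup (quasiSplit (↥(maximalRealSubfield L)) L (IsCMField.complexConj L) 2).Adelic)) => ((φ 1)⁻¹ • φ) (k : (quasiSplit (↥(maximalRealSubfield L)) L (IsCMField.complexConj L) 2).Adelic)) 2 μK :=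
    MemLp.of_bound (hψc.comp continuous_subtype_val).aestronglyMeasurable Mφ (Eventually.of_forall fun _ => hψM _)
  refine ⟨(φ 1)⁻¹ • φ, Mφ, hvm.toLp _, hψV, hψc, hψM, hVinf_maximalLevel_of_selfDual_cm L hsd _ hψV, ?_, ?_, hvm.coeFn_toLp⟩
  · rw [hψ1]; exact one_ne_zero
  · rw [hψ1, map_one]

/-! ## §3 ★ p863444 binder-free: the top row's block-model family OF RECORD -/

/-- **THE TOP-ROW BLOCK-MODEL FAMILY, BINDER-FREE** — ★ p863444 `exists_blockModelFamily_top`'s conclusion VERBATIM with every RUNG-1 structural binder discharged (§1, §2, `σ₀ := 2`; Borel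
σ-algebras on `U(J₂)(𝔸)` and `𝔸_Lˣ` by `borel _`): at `(K_max, ω = 1)` there are Hilbert spaces `A_b, Λ_b` and a family `U b : L²(𝔛) →ₗ A_b × Λ_b` over the C7 index with (`hUfac`) `U b`
factors through `P_{Sc_b}`, (`hUinj`) `U b` is injective on `Sc_b`, (`hOD`) off-dual blocks have no pure atoms, and **(O)** `(⨆_b resHAtom (U b)) ⟂ (⨆_b resHLine (U b))`.  This is the top row of
★ p865023's row packaging up to its (N_blk) and (L) clauses. [cite: MoeglinWaldspurger1995, II.1.7, II.2.1, IV.1.10, VI.2] [cite: ReedSimonI1980, Thm. II.3] -/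
theorem exists_blockModelFamily_top_of_record
    (μ : Measure (quasiSplit (↥(maximalRealSubfield L)) L (IsCMField.complexConj L) 2).automorphicQuotient) [(quasiSplit (↥(maximalRealSubfield L)) L (IsCMField.complexConj L) 2).IsAutomorphicMeasure μ] :
    ∃ (A Λ : ↥{χ : HeckeCharacter L | (∀ r : ℝ≥0ˣ, χ (posRealIdele L r) = 1) ∧ chiSectionSpace χ (((standardMaximalCompactGL 2 L).comap (adelicVal (↥(maximalRealSubfield L)) L (IsCMField.complexConj L) 2 ((StdForm.antidiagonal 2).over L)) : Subgroup (quasiSplit (↥(maximalRealSubfield L)) L (IsCMField.complexConj L) 2).Adelic)) (((1 : ↥(((standardMaximalCompactGL 2 L).comap (adelicVal (↥(maximalRealSubfield L)) L (IsCMField.complexConj L) 2 ((StdForm.antidiagonal 2).over L)) : Subgroup (quasiSplit (↥(maximalRealSubfield L)) L (IsCMField.complexConj L) 2).Adelic)) →* ℂ)) : ↥(((standardMaximalCompactGL 2 L).comap (adelicVal (↥(maximalRealSubfield L)) L (IsCMField.complexConj L) 2 ((StdForm.antidiagonal 2).over L)) : Subgroup (quasiSplit (↥(maximalRealSubfield L))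 L (IsCMField.complexConj L) 2).Adelic)) → ℂ) ≠ ⊥} → Type) (_ : ∀ b, NormedAddCommGroup (A b)) (_ : ∀ b, InnerProductSpace ℂ (A b)) (_ : ∀ b, NormedAddCommGroup (Λ b)) (_ : ∀ b, InnerProductSpace ℂ (Λ b))
      (U : ∀ b : ↥{χ : HeckeCharacter L | (∀ r : ℝ≥0ˣ, χ (posRealIdele L r) = 1) ∧ chiSectionSpace χ (((standardMaximalCompactGL 2 L).comap (adelicVal (↥(maximalRealSubfield L)) L (IsCMField.complexConj L) 2 ((StdForm.antidiagonal 2).over L)) : Subgroup (quasiSplit (↥(maximalRealSubfield L)) L (IsCMField.complexConj L) 2).Adelic)) (((1 : ↥(((standardMaximalCompactGL 2 L).comap (adelicVal (↥(maximalRealSubfield L)) L (IsCMField.complexConj L) 2 ((StdForm.antidiagonal 2).over L)) : Subgroup (quasiSplit (↥(maximalRealSubfield L)) L (IsCMField.complexConj L) 2).Adelic)) →* ℂ)) : ↥(((standardMaximalCompactGL 2 L).comap (adelicVal (↥(maximalRealSubfield L)) L (IsCMField.complexConj L) 2 ((StdForm.antidiagonal 2).over L)) : Subgroup (quasiSplit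 (↥(maximalRealSubfield L)) L (IsCMField.complexConj L) 2).Adelic)) → ℂ) ≠ ⊥}, (quasiSplit (↥(maximalRealSubfield L)) L (IsCMField.complexConj L) 2).L2 μ →ₗ[ℂ] A b × Λ b),
      (∀ (b : ↥{χ : HeckeCharacter L | (∀ r : ℝ≥0ˣ, χ (posRealIdele L r) = 1) ∧ chiSectionSpace χ (((standardMaximalCompactGL 2 L).comap (adelicVal (↥(maximalRealSubfield L)) L (IsCMField.complexConj L) 2 ((StdForm.antidiagonal 2).over L)) : Subgroup (quasiSplit (↥(maximalRealSubfield L)) L (IsCMField.complexConj L) 2).Adelic)) (((1 : ↥(((standardMaximalCompactGL 2 L).comap (adelicVal (↥(maximalRealSubfield L)) L (IsCMField.complexConj L) 2 ((StdForm.antidiagonal 2).over L)) : Subgroup (quasiSplit (↥(maximalRealSubfield L)) L (IsCMField.complexConj L) 2).Adelic)) →* ℂ)) : ↥(((standardMaximalCompactGL 2 L).comap (adelicVal (↥(maximalRealSubfield L)) L (IsCMField.complexConj L) 2 ((StdForm.antidiagonal 2).over L)) : Subgroup (quasiSplit (↥(maximalRealSubfield L)) L (IsCMField.complexConj L) 2).Adelic))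 → ℂ) ≠ ⊥}) (y : (quasiSplit (↥(maximalRealSubfield L)) L (IsCMField.complexConj L) 2).L2 μ),
        ∃ y' ∈ resHBlock L μ (((standardMaximalCompactGL 2 L).comap (adelicVal (↥(maximalRealSubfield L)) L (IsCMField.complexConj L) 2 ((StdForm.antidiagonal 2).over L)) : Subgroup (quasiSplit (↥(maximalRealSubfield L)) L (IsCMField.complexConj L) 2).Adelic)) (1 : ↥(((standardMaximalCompactGL 2 L).comap (adelicVal (↥(maximalRealSubfield L)) L (IsCMField.complexConj L) 2 ((StdForm.antidiagonal 2).over L)) : Subgroup (quasiSplit (↥(maximalRealSubfield L)) L (IsCMField.complexConj L) 2).Adelic)) →* ℂ) (b : HeckeCharacter L), y - y' ∈ (resHBlock L μ (((standardMaximalCompactGL 2 L).comap (adelicVal (↥(maximalRealSubfield L)) L (IsCMField.complexConj L) 2 ((StdForm.antidiagonal 2).over L)) : Subgroup (quasiSplit (↥(maximalRealSubfield L)) L (IsCMField.complexConj L) 2).Adelic)) (1 : ↥(((standardMaximalCompactGL 2 L).comap (adelicVal (↥(maximalRealSubfield L)) L (IsCMField.complexConj L) 2 ((StdForm.antidiagonal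 2).over L)) : Subgroup (quasiSplit (↥(maximalRealSubfield L)) L (IsCMField.complexConj L) 2).Adelic)) →* ℂ) (b : HeckeCharacter L))ᗮ ∧ U b y = U b y') ∧
      (∀ (b : ↥{χ : HeckeCharacter L | (∀ r : ℝ≥0ˣ, χ (posRealIdele L r) = 1) ∧ chiSectionSpace χ (((standardMaximalCompactGL 2 L).comap (adelicVal (↥(maximalRealSubfield L)) L (IsCMField.complexConj L) 2 ((StdForm.antidiagonal 2).over L)) : Subgroup (quasiSplit (↥(maximalRealSubfield L)) L (IsCMField.complexConj L) 2).Adelic)) (((1 : ↥(((standardMaximalCompactGL 2 L).comap (adelicVal (↥(maximalRealSubfield L)) L (IsCMField.complexConj L) 2 ((StdForm.antidiagonal 2).over L)) : Subgroup (quasiSplit (↥(maximalRealSubfield L)) L (IsCMField.complexConj L) 2).Adelic)) →* ℂ)) : ↥(((standardMaximalCompactGL 2 L).comap (adelicVal (↥(maximalRealSubfield L)) L (IsCMField.complexConj L) 2 ((StdForm.antidiagonal 2).over L)) : Subgroup (quasiSplit (↥(maximalRealSubfield L)) L (IsCMField.complexConj L) 2).Adelic)) → ℂ) ≠ ⊥}),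 ∀ y ∈ resHBlock L μ (((standardMaximalCompactGL 2 L).comap (adelicVal (↥(maximalRealSubfield L)) L (IsCMField.complexConj L) 2 ((StdForm.antidiagonal 2).over L)) : Subgroup (quasiSplit (↥(maximalRealSubfield L)) L (IsCMField.complexConj L) 2).Adelic)) (1 : ↥(((standardMaximalCompactGL 2 L).comap (adelicVal (↥(maximalRealSubfield L)) L (IsCMField.complexConj L) 2 ((StdForm.antidiagonal 2).over L)) : Subgroup (quasiSplit (↥(maximalRealSubfield L)) L (IsCMField.complexConj L) 2).Adelic)) →* ℂ) (b : HeckeCharacter L), U b y = 0 → y = 0) ∧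
      (∀ b : ↥{χ : HeckeCharacter L | (∀ r : ℝ≥0ˣ, χ (posRealIdele L r) = 1) ∧ chiSectionSpace χ (((standardMaximalCompactGL 2 L).comap (adelicVal (↥(maximalRealSubfield L)) L (IsCMField.complexConj L) 2 ((StdForm.antidiagonal 2).over L)) : Subgroup (quasiSplit (↥(maximalRealSubfield L)) L (IsCMField.complexConj L) 2).Adelic)) (((1 : ↥(((standardMaximalCompactGL 2 L).comap (adelicVal (↥(maximalRealSubfield L)) L (IsCMField.complexConj L) 2 ((StdForm.antidiagonal 2).over L)) : Subgroup (quasiSplit (↥(maximalRealSubfield L)) L (IsCMField.complexConj L) 2).Adelic)) →* ℂ)) : ↥(((standardMaximalCompactGL 2 L).comap (adelicVal (↥(maximalRealSubfield L)) L (IsCMField.complexConj L) 2 ((StdForm.antidiagonal 2).over L)) : Subgroup (quasiSplit (↥(maximalRealSubfield L)) L (IsCMField.complexConj L) 2).Adelic)) → ℂ) ≠ ⊥}, reflectChar (IsCMField.complexConj L) (b : HeckeCharacter L) ≠ (b : HeckeCharacter L) → resHAtom L μ (U b) (((standardMaximalCompactGL 2 L).comap (adelicVal (↥(maximalRealSubfield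 L)) L (IsCMField.complexConj L) 2 ((StdForm.antidiagonal 2).over L)) : Subgroup (quasiSplit (↥(maximalRealSubfield L)) L (IsCMField.complexConj L) 2).Adelic)) (1 : ↥(((standardMaximalCompactGL 2 L).comap (adelicVal (↥(maximalRealSubfield L)) L (IsCMField.complexConj L) 2 ((StdForm.antidiagonal 2).over L)) : Subgroup (quasiSplit (↥(maximalRealSubfield L)) L (IsCMField.complexConj L) 2).Adelic)) →* ℂ) (b : HeckeCharacter L) = ⊥) ∧
      (⨆ b : ↥{χ : HeckeCharacter L | (∀ r : ℝ≥0ˣ, χ (posRealIdele L r) = 1) ∧ chiSectionSpace χ (((standardMaximalCompactGL 2 L).comap (adelicVal (↥(maximalRealSubfield L)) L (IsCMField.complexConj L) 2 ((StdForm.antidiagonal 2).over L)) : Subgroup (quasiSplit (↥(maximalRealSubfield L)) L (IsCMField.complexConj L) 2).Adelic)) (((1 : ↥(((standardMaximalCompactGL 2 L).comap (adelicVal (↥(maximalRealSubfield L)) L (IsCMField.complexConj L) 2 ((StdForm.antidiagonal 2).over L)) : Subgroup (quasiSplit (↥(maximalRealSubfield L)) L (IsCMField.complexConj L) 2).Adelic))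 →* ℂ)) : ↥(((standardMaximalCompactGL 2 L).comap (adelicVal (↥(maximalRealSubfield L)) L (IsCMField.complexConj L) 2 ((StdForm.antidiagonal 2).over L)) : Subgroup (quasiSplit (↥(maximalRealSubfield L)) L (IsCMField.complexConj L) 2).Adelic)) → ℂ) ≠ ⊥}, resHAtom L μ (U b) (((standardMaximalCompactGL 2 L).comap (adelicVal (↥(maximalRealSubfield L)) L (IsCMField.complexConj L) 2 ((StdForm.antidiagonal 2).over L)) : Subgroup (quasiSplit (↥(maximalRealSubfield L)) L (IsCMField.complexConj L) 2).Adelic)) (1 : ↥(((standardMaximalCompactGL 2 L).comap (adelicVal (↥(maximalRealSubfield L)) L (IsCMField.complexConj L) 2 ((StdForm.antidiagonal 2).over L)) : Subgroup (quasiSplit (↥(maximalRealSubfield L)) L (IsCMField.complexConj L) 2).Adelic)) →* ℂ) (b : HeckeCharacter L)) ⟂ (⨆ b : ↥{χ : HeckeCharacter L | (∀ r : ℝ≥0ˣ, χ (posRealIdele L r) = 1) ∧ chiSectionSpace χ (((standardMaximalCompactGL 2 L).comap (adelicVal (↥(maximalRealSubfield L)) L (IsCMField.complexConj L) 2 ((StdForm.antidiagonal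 2).over L)) : Subgroup (quasiSplit (↥(maximalRealSubfield L)) L (IsCMField.complexConj L) 2).Adelic)) (((1 : ↥(((standardMaximalCompactGL 2 L).comap (adelicVal (↥(maximalRealSubfield L)) L (IsCMField.complexConj L) 2 ((StdForm.antidiagonal 2).over L)) : Subgroup (quasiSplit (↥(maximalRealSubfield L)) L (IsCMField.complexConj L) 2).Adelic)) →* ℂ)) : ↥(((standardMaximalCompactGL 2 L).comap (adelicVal (↥(maximalRealSubfield L)) L (IsCMField.complexConj L) 2 ((StdForm.antidiagonal 2).over L)) : Subgroup (quasiSplit (↥(maximalRealSubfield L)) L (IsCMField.complexConj L) 2).Adelic)) → ℂ) ≠ ⊥}, resHLine L μ (U b) (((standardMaximalCompactGL 2 L).comap (adelicVal (↥(maximalRealSubfield L)) L (IsCMField.complexConj L) 2 ((StdForm.antidiagonal 2).over L)) : Subgroup (quasiSplit (↥(maximalRealSubfield L)) L (IsCMField.complexConj L) 2).Adelic)) (1 : ↥(((standardMaximalCompactGL 2 L).comap (adelicVal (↥(maximalRealSubfield L)) L (IsCMField.complexConj L) 2 ((StdForm.antidiagonal 2).over L)) : Subgroup (quasiSplit (↥(maximalRealSubfield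 L)) L (IsCMField.complexConj L) 2).Adelic)) →* ℂ) (b : HeckeCharacter L)) := by
  classical
  letI : MeasurableSpace (quasiSplit (↥(maximalRealSubfield L)) L (IsCMField.complexConj L) 2).Adelic := borel _
  haveI : BorelSpace (quasiSplit (↥(maximalRealSubfield L)) L (IsCMField.complexConj L) 2).Adelic := ⟨rfl⟩
  letI : MeasurableSpace (AdeleRing (𝓞 L) L)ˣ := borel _
  haveI : BorelSpace (AdeleRing (𝓞 L) L)ˣ := ⟨rfl⟩
  have HS := exists_structuralBinders_top L
  obtain ⟨νG, hνG, hνGinv, hνGsf, μK, hμK, νI, hνI, 𝓕I, h𝓕I, ν, hν, hνr, hνinv, 𝓕, h𝓕N, h𝓕1, h𝓕c, β, hβ, μZ, hμZsf, hμZ, hc⟩ := HS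
  haveI := hνG; haveI := hνGinv; haveI := hνGsf; haveI := hμK; haveI := hνI; haveI := hν; haveI := hνr; haveI := hνinv; haveI := hμZsf
  haveI : CompactSpace ↥(((standardMaximalCompactGL 2 L).comap (adelicVal (↥(maximalRealSubfield L)) L (IsCMField.complexConj L) 2 ((StdForm.antidiagonal 2).over L)) : Subgroup (quasiSplit (↥(maximalRealSubfield L)) L (IsCMField.complexConj L) 2).Adelic)) :=
    isCompact_iff_compactSpace.1 isCompact_comap_adelicVal_standardMaximalCompactGL
  haveI : IsFiniteMeasure μK := CompactSpace.isFiniteMeasure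
  have key : ∀ (b : ↥{χ : HeckeCharacter L | (∀ r : ℝ≥0ˣ, χ (posRealIdele L r) = 1) ∧ chiSectionSpace χ (((standardMaximalCompactGL 2 L).comap (adelicVal (↥(maximalRealSubfield L)) L (IsCMField.complexConj L) 2 ((StdForm.antidiagonal 2).over L)) : Subgroup (quasiSplit (↥(maximalRealSubfield L)) L (IsCMField.complexConj L) 2).Adelic)) (((1 : ↥(((standardMaximalCompactGL 2 L).comap (adelicVal (↥(maximalRealSubfield L)) L (IsCMField.complexConj L) 2 ((StdForm.antidiagonal 2).over L)) : Subgroup (quasiSplit (↥(maximalRealSubfield L)) L (IsCMField.complexConj L) 2).Adelic)) →* ℂ)) : ↥(((standardMaximalCompactGL 2 L).comap (adelicVal (↥(maximalRealSubfield L)) L (IsCMField.complexConj L) 2 ((StdForm.antidiagonal 2).over L)) : Subgroup (quasiSplit (↥(maximalRealSubfield L)) L (IsCMField.complexConj L) 2).Adelic)) → ℂ) ≠ ⊥}) (h : reflectChar (IsCMField.complexConj L) (b : HeckeCharacter L) = (b : HeckeCharacter L)),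
      ∃ (φ₀ : (quasiSplit (↥(maximalRealSubfield L)) L (IsCMField.complexConj L) 2).Adelic → ℂ) (Mφ : ℝ) (v : Lp ℂ 2 μK),
        φ₀ ∈ chiSectionSpace (b : HeckeCharacter L) (((standardMaximalCompactGL 2 L).comap (adelicVal (↥(maximalRealSubfield L)) L (IsCMField.complexConj L) 2 ((StdForm.antidiagonal 2).over L)) : Subgroup (quasiSplit (↥(maximalRealSubfield L)) L (IsCMField.complexConj L) 2).Adelic)) (fun _ => 1) ∧ Continuous φ₀ ∧ (∀ x, ‖φ₀ x‖ ≤ Mφ) ∧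
        (∀ a : arch (↥(maximalRealSubfield L)) L (IsCMField.complexConj L) 2 ((StdForm.antidiagonal 2).over L), φ₀ (archToAdelic (↥(maximalRealSubfield L)) L (IsCMField.complexConj L) 2 _ a) = φ₀ 1) ∧ φ₀ 1 ≠ 0 ∧ conj (φ₀ 1) = φ₀ 1 ∧
        ((v : Lp ℂ 2 μK) : ↥(((standardMaximalCompactGL 2 L).comap (adelicVal (↥(maximalRealSubfield L)) L (IsCMField.complexConj L) 2 ((StdForm.antidiagonal 2).over L)) : Subgroup (quasiSplit (↥(maximalRealSubfield L)) L (IsCMField.complexConj L) 2).Adelic)) → ℂ) =ᵐ[μK] fun k => φ₀ (k : (quasiSplit (↥(maximalRealSubfield L)) L (IsCMField.complexConj L) 2).Adelic) :=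
    fun b h => exists_normalisedSection_selfDual_top L μK b h
  choose φ₀ Mφ v hφV hφc hφM hφinf hφ1 hφ1r hv using key
  exact exists_blockModelFamily_top L μ νG μK νI h𝓕I ν h𝓕N h𝓕1 h𝓕c hβ hμZ hc φ₀ hφV hφc Mφ hφM hφinf hφ1 hφ1r v hv one_lt_two

end Summit.HodgeConjecture.HodgeConjecture.R90.S8

end
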